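import Summits.RiemannHypothesis.RiemannHypothesis.Theorems.GroundBartaEvenWinsBeyondArchLatticeRippleTChain
import HarnessLib

/-!
# RiemannHypothesis / GroundBarta machinery — LATTICE RIPPLES: the chain layer (2/2), moments and sup bounds

Helper file (`--supports stmt-RiemannHypothesis-18085`; infrastructure for the Weil-positivity ladder), RH-free, axioms
standard.  Seat rh-explicit-weil-1.  Verbatim adaptation of the moment / sup-bound half of `WeilTwoPrimeMinorant.lean` to
the lattice-ripple chain `cellsSigmaX` of `…LatticeRippleChain.lean`:

* the step bound `xStepAux` (`|σ_{X,≥0}| ≤ Σ_j 1_{[u_j,v_j)} absQ_j`), its moments `xCellsAbsMomentQ`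
  (`integral_xStepAux_mul_pow`);
* exact moments `xCellsMomentQ` and `integral_cellsSigmaX_mul_pow` (`∫ σ_X(t) t^q dt = 2 Σ_j momentQ_j(q)`, even `q`);
* `xCellsBndMaxQ` and the sup bound `abs_cellsSigmaX_le_bndMax` (`|σ_X| ≤ max_j absQ_j`), the `|σ_X|`-moment bound
  `integral_abs_cellsSigmaX_mul_pow_le` (`∫ |σ_X| t^q ≤ 2 · xCellsAbsMomentQ q`, even `q`);
* all parities: `integral_cellsSigmaX_pow` (odd moments vanish by evenness).
Everything here is proved; no named facts.
-/

set_option linter.dupNamespace false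

noncomputable section

open Complex Filter Set MeasureTheory
open scoped Real Topology

namespace Summit.RiemannHypothesis.RiemannHypothesis.Theorems.EvenWinsBeyondArch

open Literature.NumberTheory.LFunctions

/-! ## The step bound and its moments -/

/-- The step function `Σ_j absQ_j 1_{[u_j, v_j)}` dominating `|σ_{X,≥0}|`. [folklore] -/
def xStepAux : List XTCell → ℝ → ℝ
  | [], _ => 0
  | c :: cs, s => Set.indicator (Ico (c.u : ℝ) c.v) (fun _ ↦ ((c.absQ : ℚ) : ℝ)) s + xStepAux cs s

/-- `|σ_{X,≥0}(s)| ≤ step(s)` when all cells are valid. [folklore] -/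
theorem abs_xSigmaAux_le_step {cells : List XTCell} (hall : ∀ c ∈ cells, c.Valid) (s : ℝ) :
    |xSigmaAux cells s| ≤ xStepAux cells s := by
  induction cells with
  | nil => simp [xSigmaAux, xStepAux]
  | cons c cs ih =>
    simp only [xSigmaAux, xStepAux]
    refine (abs_add_le _ _).trans (add_le_add ?_ (ih fun c' hc' ↦ hall c' (by simp [hc'])))
    by_cases hs : s ∈ Ico (c.u : ℝ) c.v
    · rw [Set.indicator_of_mem hs, Set.indicator_of_mem hs]
      exact (hall c (by simp)).abs_le s hs.1 hs.2.le
    · rw [Set.indicator_of_notMem hs, Set.indicator_of_notMem hs, abs_zero]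

/-- `step` is bounded, nonnegative and measurable. [folklore] -/
theorem xStepAux_props {cells : List XTCell} (hall : ∀ c ∈ cells, c.Valid) :
    (∃ B, ∀ s, 0 ≤ xStepAux cells s ∧ xStepAux cells s ≤ B) ∧ Measurable (xStepAux cells) := by
  induction cells with
  | nil => exact ⟨⟨0, fun s ↦ by simp [xStepAux]⟩, measurable_const⟩
  | cons c cs ih =>
    obtain ⟨⟨B, hB⟩, hm⟩ := ih fun c' hc' ↦ hall c' (by simp [hc'])
    have hb0 : (0 : ℝ) ≤ ((c.absQ : ℚ) : ℝ) := by exact_mod_cast (hall c (by simp)).absQ_nonneg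
    refine ⟨⟨((c.absQ : ℚ) : ℝ) + B, fun s ↦ ?_⟩, ?_⟩
    · simp only [xStepAux]
      by_cases hs : s ∈ Ico (c.u : ℝ) c.v
      · rw [Set.indicator_of_mem hs]; exact ⟨add_nonneg hb0 (hB s).1, add_le_add le_rfl (hB s).2⟩
      · rw [Set.indicator_of_notMem hs, zero_add]
        exact ⟨(hB s).1, (hB s).2.trans (by linarith)⟩
    · change Measurable fun s ↦
        Set.indicator (Ico (c.u : ℝ) c.v) (fun _ ↦ ((c.absQ : ℚ) : ℝ)) s + xStepAux cs s
      exact (measurable_const.indicator measurableSet_Ico).add hm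

/-- The moments of the step bound: `Σ_j absQ_j (v_j^{q+1} − u_j^{q+1})/(q+1)`. [folklore] -/
def xCellsAbsMomentQ : List XTCell → ℕ → ℚ
  | [], _ => 0
  | c :: cs, q => c.absQ * c.powIntQ (q + 1) + xCellsAbsMomentQ cs q

/-- **Moments of the step bound.** `s ↦ step(s) s^q` is integrable and `∫ step(s) s^q ds = xCellsAbsMomentQ`. [folklore] -/
theorem integral_xStepAux_mul_pow {cells : List XTCell} (hall : ∀ c ∈ cells, c.Valid) (q : ℕ) :
    Integrable (fun s ↦ xStepAux cells s * s ^ q) ∧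
      ∫ s, xStepAux cells s * s ^ q = (xCellsAbsMomentQ cells q : ℝ) := by
  induction cells with
  | nil => simp [xStepAux, xCellsAbsMomentQ]
  | cons c cs ih =>
    obtain ⟨ihi, ihv⟩ := ih fun c' hc' ↦ hall c' (by simp [hc'])
    have huv : (c.u : ℝ) ≤ c.v := by exact_mod_cast ((hall c (by simp)).u_lt_v).le
    have e : (fun s ↦ xStepAux (c :: cs) s * s ^ q) = fun s ↦
        Set.indicator (Ico (c.u : ℝ) c.v) (fun s ↦ ((c.absQ : ℚ) : ℝ) * s ^ q) s + xStepAux cs s * s ^ q := by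
      funext s
      simp only [xStepAux, add_mul, Set.indicator_mul_left]
    rw [e]
    have i1 : Integrable fun s : ℝ ↦
        Set.indicator (Ico (c.u : ℝ) c.v) (fun s ↦ ((c.absQ : ℚ) : ℝ) * s ^ q) s := by
      rw [integrable_indicator_iff measurableSet_Ico]
      exact ((continuous_const.mul (continuous_pow q)).continuousOn.integrableOn_Icc
        (a := (c.u : ℝ)) (b := c.v)).mono_set Ico_subset_Icc_self
    refine ⟨i1.add ihi, ?_⟩
    rw [integral_add i1 ihi, ihv, integral_indicator measurableSet_Ico, integral_Ico_eq_integral_Ioo,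
      ← integral_Ioc_eq_integral_Ioo, ← intervalIntegral.integral_of_le huv,
      intervalIntegral.integral_const_mul, XTCell.integral_pow_eq_powIntQ, xCellsAbsMomentQ]
    push_cast
    ring

/-! ## Exact moments -/

/-- The moments of `σ_{X,≥0}`: `Σ_j momentQ_j`. [folklore] -/
def xCellsMomentQ : List XTCell → ℕ → ℚ
  | [], _ => 0
  | c :: cs, q => c.momentQ q + xCellsMomentQ cs q

section Moments

/-- The cell integrands `1_{[u,v)} σ_{X,j} s^q` are integrable. [folklore] -/
theorem integrable_indicator_xcell (c : XTCell) (q : ℕ) :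
    Integrable fun s : ℝ ↦ Set.indicator (Ico (c.u : ℝ) c.v) (fun s ↦ c.sigma s * s ^ q) s := by
  rw [integrable_indicator_iff measurableSet_Ico]
  exact ((c.continuous_sigma.mul (continuous_pow q)).continuousOn.integrableOn_Icc
    (a := (c.u : ℝ)) (b := c.v)).mono_set Ico_subset_Icc_self

/-- **Moments of `σ_{X,≥0}`.** `s ↦ σ_{X,≥0}(s) s^q` is integrable and `∫ σ_{X,≥0}(s) s^q ds = Σ_j momentQ_j`. [folklore] -/
theorem integral_xSigmaAux_mul_pow {cells : List XTCell} (hall : ∀ c ∈ cells, c.Valid) (q : ℕ) :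
    Integrable (fun s ↦ xSigmaAux cells s * s ^ q) ∧
      ∫ s, xSigmaAux cells s * s ^ q = (xCellsMomentQ cells q : ℝ) := by
  induction cells with
  | nil => simp [xSigmaAux, xCellsMomentQ]
  | cons c cs ih =>
    obtain ⟨ihi, ihv⟩ := ih fun c' hc' ↦ hall c' (by simp [hc'])
    have huv : (c.u : ℝ) ≤ c.v := by exact_mod_cast ((hall c (by simp)).u_lt_v).le
    have e : (fun s ↦ xSigmaAux (c :: cs) s * s ^ q) = fun s ↦
        Set.indicator (Ico (c.u : ℝ) c.v) (fun s ↦ c.sigma s * s ^ q) s + xSigmaAux cs s * s ^ q := by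
      funext s
      simp only [xSigmaAux, add_mul, Set.indicator_mul_left]
    rw [e]
    have i1 := integrable_indicator_xcell c q
    refine ⟨i1.add ihi, ?_⟩
    rw [integral_add i1 ihi, ihv, integral_indicator measurableSet_Ico, integral_Ico_eq_integral_Ioo,
      ← integral_Ioc_eq_integral_Ioo, ← intervalIntegral.integral_of_le huv,
      XTCell.integral_sigma_mul_pow, xCellsMomentQ]
    push_cast
    ring

variable {rs : List (ℤ × ℤ × ℚ)} {T : ℚ} {cells : List XTCell}

/-- **Moments of `σ_X`.** For even `q`, `t ↦ σ_X(t) t^q` is integrable and `∫ σ_X(t) t^q dt = 2 Σ_j momentQ_j(q)`. [folklore] -/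
theorem integral_cellsSigmaX_mul_pow (h : XCellsOK rs T cells) {q : ℕ} (hq : Even q) :
    Integrable (fun t ↦ cellsSigmaX cells t * t ^ q) ∧
      ∫ t, cellsSigmaX cells t * t ^ q = 2 * (xCellsMomentQ cells q : ℝ) := by
  have hchain := h.chain
  have hall := h.valid
  obtain ⟨hFi, hFv⟩ := integral_xSigmaAux_mul_pow hall q
  set F : ℝ → ℝ := fun s ↦ xSigmaAux cells s * s ^ q with hF
  have hev : (fun t ↦ cellsSigmaX cells t * t ^ q) = fun t ↦ F |t| := by
    funext t
    rw [hF, cellsSigmaX]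
    simp only
    rw [hq.pow_abs]
  rw [hev]
  have hF0 : ∀ s, s ∉ Ici (0 : ℝ) → F s = 0 := fun s hs ↦ by
    rw [hF]
    simp only
    rw [xSigmaAux_eq_zero hchain hall (Or.inl (by simpa using hs)), zero_mul]
  constructor
  · obtain ⟨B, hB⟩ := exists_abs_xSigmaAux_le cells
    have hT0 : (0 : ℝ) ≤ T := by exact_mod_cast (chain_boundsX hchain hall).1
    have hmeas : Measurable fun t ↦ F |t| := by
      rw [hF]
      exact ((measurable_xSigmaAux cells).mul (measurable_id.pow_const q)).comp continuous_abs.measurable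
    have hconst : IntegrableOn (fun _ : ℝ ↦ B * (T : ℝ) ^ q) (Icc (-(T : ℝ)) T) :=
      integrableOn_const measure_Icc_lt_top.ne
    refine Integrable.mono' ((integrable_indicator_iff measurableSet_Icc).2 hconst)
      hmeas.aestronglyMeasurable (Eventually.of_forall fun t ↦ ?_)
    by_cases ht : |t| < T
    · have hmem : t ∈ Icc (-(T : ℝ)) T := ⟨by linarith [neg_abs_le t], by linarith [le_abs_self t]⟩
      rw [Set.indicator_of_mem hmem, hF, Real.norm_eq_abs]
      simp only
      rw [abs_mul, abs_pow, abs_abs]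
      exact mul_le_mul (hB _) (pow_le_pow_left₀ (abs_nonneg t) ht.le q) (by positivity)
        ((abs_nonneg _).trans (hB 0))
    · push Not at ht
      rw [hF, Real.norm_eq_abs]
      simp only
      rw [xSigmaAux_eq_zero hchain hall (Or.inr ht), zero_mul, abs_zero]
      exact Set.indicator_nonneg (fun _ _ ↦ by
        have := (abs_nonneg _).trans (hB 0); positivity) _
  · rw [integral_comp_abs (f := F), ← integral_Ici_eq_integral_Ioi,
      setIntegral_eq_integral_of_forall_compl_eq_zero hF0, hFv]

end Moments

/-! ## Sup bounds and `|σ_X|`-moments -/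

/-- `max_j absQ_j` (`0` for no cells). [folklore] -/
def xCellsBndMaxQ : List XTCell → ℚ
  | [] => 0
  | c :: cs => max c.absQ (xCellsBndMaxQ cs)

/-- `0 ≤ max_j absQ_j`. [folklore] -/
theorem xCellsBndMaxQ_nonneg : ∀ cells : List XTCell, 0 ≤ xCellsBndMaxQ cells
  | [] => le_rfl
  | _ :: cs => (xCellsBndMaxQ_nonneg cs).trans (le_max_right _ _)

section AbsMoments

variable {rs : List (ℤ × ℤ × ℚ)} {T : ℚ} {cells : List XTCell}

/-- `step` vanishes off `[s₀, T)` for a chain of valid cells from `s₀` to `T`. [folklore] -/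
theorem xStepAux_eq_zero {s₀ : ℚ} (hchain : checkChainX cells s₀ T = true) (hall : ∀ c ∈ cells, c.Valid)
    {x : ℝ} (hx : x < s₀ ∨ (T : ℝ) ≤ x) : xStepAux cells x = 0 := by
  induction cells generalizing s₀ with
  | nil => rfl
  | cons c cs ih =>
    have hb := chain_boundsX hchain hall
    simp only [checkChainX, Bool.and_eq_true, decide_eq_true_eq] at hchain
    have hcv : (c.v : ℝ) ≤ T := by exact_mod_cast (hb.2 c (by simp)).2
    have huv : (c.u : ℝ) < c.v := by exact_mod_cast (hall c (by simp)).u_lt_v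
    have hus : (c.u : ℝ) = s₀ := by exact_mod_cast hchain.1
    simp only [xStepAux]
    rw [ih hchain.2 (fun c' hc' ↦ hall c' (by simp [hc'])) ?_, add_zero, Set.indicator_of_notMem]
    · rintro ⟨h1, h2⟩
      rcases hx with hx | hx <;> linarith
    · rcases hx with hx | hx
      · left; linarith
      · right; exact hx

/-- `step(s) ≤ max_j absQ_j` for a chain. [folklore] -/
theorem xStepAux_le_bndMax {s₀ : ℚ} (hchain : checkChainX cells s₀ T = true) (hall : ∀ c ∈ cells, c.Valid)
    (s : ℝ) : xStepAux cells s ≤ (xCellsBndMaxQ cells : ℝ) := by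
  induction cells generalizing s₀ with
  | nil => simp [xStepAux, xCellsBndMaxQ]
  | cons c cs ih =>
    simp only [checkChainX, Bool.and_eq_true, decide_eq_true_eq] at hchain
    have hall' : ∀ c' ∈ cs, c'.Valid := fun c' hc' ↦ hall c' (by simp [hc'])
    simp only [xStepAux, xCellsBndMaxQ]
    push_cast
    by_cases hs : s ∈ Ico (c.u : ℝ) c.v
    · rw [Set.indicator_of_mem hs, xStepAux_eq_zero hchain.2 hall' (Or.inl hs.2), add_zero]
      exact le_max_left _ _
    · rw [Set.indicator_of_notMem hs, zero_add]
      exact (ih hchain.2 hall').trans (le_max_right _ _)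

/-- **Sup bound.** `|σ_X(t)| ≤ max_j absQ_j` for all real `t`. [folklore] -/
theorem abs_cellsSigmaX_le_bndMax (h : XCellsOK rs T cells) (t : ℝ) :
    |cellsSigmaX cells t| ≤ (xCellsBndMaxQ cells : ℝ) := by
  unfold cellsSigmaX
  exact (abs_xSigmaAux_le_step h.valid |t|).trans (xStepAux_le_bndMax h.chain h.valid |t|)

/-- **`|σ_X|`-moments.** For even `q`, `t ↦ |σ_X(t)| t^q` is integrable and `∫ |σ_X(t)| t^q dt ≤ 2 · xCellsAbsMomentQ(q)`. [folklore] -/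
theorem integral_abs_cellsSigmaX_mul_pow_le (h : XCellsOK rs T cells) {q : ℕ} (hq : Even q) :
    Integrable (fun t ↦ |cellsSigmaX cells t| * t ^ q) ∧
      ∫ t, |cellsSigmaX cells t| * t ^ q ≤ 2 * (xCellsAbsMomentQ cells q : ℝ) := by
  have hchain := h.chain
  have hall := h.valid
  obtain ⟨hFi, -⟩ := integral_cellsSigmaX_mul_pow h hq
  obtain ⟨⟨B, hB⟩, hSm⟩ := xStepAux_props hall
  obtain ⟨-, hSv⟩ := integral_xStepAux_mul_pow hall q
  have hT0 : (0 : ℝ) ≤ T := by exact_mod_cast (chain_boundsX hchain hall).1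
  have hev : (fun t ↦ |cellsSigmaX cells t| * t ^ q) = fun t ↦ |cellsSigmaX cells t * t ^ q| := by
    funext t; rw [abs_mul, abs_pow, hq.pow_abs]
  have hint : Integrable (fun t ↦ |cellsSigmaX cells t| * t ^ q) := by rw [hev]; exact hFi.abs
  refine ⟨hint, ?_⟩
  set G : ℝ → ℝ := fun s ↦ xStepAux cells s * s ^ q with hG
  have hG0 : ∀ s, s ∉ Ici (0 : ℝ) → G s = 0 := fun s hs ↦ by
    rw [hG]; simp only
    rw [xStepAux_eq_zero hchain hall (Or.inl (by simpa using hs)), zero_mul]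
  have hle : ∀ t, |cellsSigmaX cells t| * t ^ q ≤ G |t| := by
    intro t
    rw [hG]; simp only
    rw [hq.pow_abs]
    refine mul_le_mul_of_nonneg_right ?_ (by rw [← hq.pow_abs]; positivity)
    unfold cellsSigmaX
    exact abs_xSigmaAux_le_step hall |t|
  have hB0 : 0 ≤ B := (hB 0).1.trans (hB 0).2
  have hmeas : Measurable fun t ↦ G |t| := by
    rw [hG]; exact (hSm.mul (measurable_id.pow_const q)).comp continuous_abs.measurable
  have hconst : IntegrableOn (fun _ : ℝ ↦ B * (T : ℝ) ^ q) (Icc (-(T : ℝ)) T) :=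
    integrableOn_const measure_Icc_lt_top.ne
  have hGi : Integrable fun t ↦ G |t| := by
    refine Integrable.mono' ((integrable_indicator_iff measurableSet_Icc).2 hconst)
      hmeas.aestronglyMeasurable (Eventually.of_forall fun t ↦ ?_)
    by_cases ht : |t| < T
    · have hmem : t ∈ Icc (-(T : ℝ)) T := ⟨by linarith [neg_abs_le t], by linarith [le_abs_self t]⟩
      rw [Set.indicator_of_mem hmem, hG, Real.norm_eq_abs]
      simp only
      rw [abs_mul, abs_pow, abs_abs, abs_of_nonneg (hB _).1]
      exact mul_le_mul (hB _).2 (pow_le_pow_left₀ (abs_nonneg t) ht.le q) (by positivity) hB0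
    · push Not at ht
      rw [hG, Real.norm_eq_abs]
      simp only
      rw [xStepAux_eq_zero hchain hall (Or.inr ht), zero_mul, abs_zero]
      exact Set.indicator_nonneg (fun _ _ ↦ by positivity) _
  have hmono := integral_mono hint hGi hle
  refine hmono.trans (le_of_eq ?_)
  rw [integral_comp_abs (f := G), ← integral_Ici_eq_integral_Ioi,
    setIntegral_eq_integral_of_forall_compl_eq_zero hG0, hSv]

/-- `0 ≤ xCellsAbsMomentQ q` for even `q`. [folklore] -/
theorem xCellsAbsMomentQ_nonneg (h : XCellsOK rs T cells) {q : ℕ} (hq : Even q) :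
    (0 : ℝ) ≤ (xCellsAbsMomentQ cells q : ℝ) := by
  rw [← (integral_xStepAux_mul_pow h.valid q).2]
  refine integral_nonneg fun s ↦ mul_nonneg ((xStepAux_props h.valid).1.choose_spec s).1 ?_
  rw [← hq.pow_abs]; positivity

/-- **All parities.** `t ↦ σ_X(t) t^q` is integrable and `∫ σ_X t^q = 2 Σ_j momentQ_j(q)` for even `q`, `0` for odd `q`. [folklore] -/
theorem integral_cellsSigmaX_pow (h : XCellsOK rs T cells) (q : ℕ) :
    Integrable (fun t ↦ cellsSigmaX cells t * t ^ q) ∧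
      ∫ t, cellsSigmaX cells t * t ^ q = if Even q then 2 * (xCellsMomentQ cells q : ℝ) else 0 := by
  rcases Nat.even_or_odd q with hq | hq
  · rw [if_pos hq]; exact integral_cellsSigmaX_mul_pow h hq
  · rw [if_neg (Nat.not_even_iff_odd.2 hq)]
    have h0 := (integral_abs_cellsSigmaX_mul_pow_le h Even.zero).1
    have h1 := (integral_abs_cellsSigmaX_mul_pow_le h hq.add_one).1
    simp only [pow_zero, mul_one] at h0
    set γ := cellsSigmaX cells with hγ
    have hint : Integrable (fun t ↦ γ t * t ^ q) := by
      refine Integrable.mono' (h0.add h1)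
        (((measurable_cellsSigmaX _).mul (measurable_id.pow_const q)).aestronglyMeasurable)
        (Eventually.of_forall fun t ↦ ?_)
      rw [Real.norm_eq_abs, abs_mul]
      simp only [Pi.add_apply]
      rw [show |γ t| + |γ t| * t ^ (q + 1) = |γ t| * (1 + t ^ (q + 1)) by ring]
      refine mul_le_mul_of_nonneg_left ?_ (abs_nonneg _)
      rw [abs_pow]
      rcases le_or_gt |t| 1 with ht | ht
      · have : |t| ^ q ≤ 1 := pow_le_one₀ (abs_nonneg t) ht
        have : 0 ≤ t ^ (q + 1) := by rw [← (hq.add_one).pow_abs]; positivity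
        linarith
      · have : |t| ^ q ≤ |t| ^ (q + 1) := pow_le_pow_right₀ ht.le (Nat.le_succ q)
        rw [(hq.add_one).pow_abs] at this
        linarith
    refine ⟨hint, ?_⟩
    have hodd : ∀ t, γ (-t) * (-t) ^ q = -(γ t * t ^ q) := by
      intro t; rw [hγ, cellsSigmaX_neg, hq.neg_pow]; ring
    have h2 := integral_neg_eq_self (fun t ↦ γ t * t ^ q) volume
    simp_rw [hodd] at h2
    rw [integral_neg] at h2
    linarith

end AbsMoments

/-! ## Splitting a chain into chunks (for per-chunk kernel facts) -/

/-- `xCellsMomentQ` is additive over concatenation. [folklore] -/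
theorem xCellsMomentQ_append (l₁ l₂ : List XTCell) (q : ℕ) :
    xCellsMomentQ (l₁ ++ l₂) q = xCellsMomentQ l₁ q + xCellsMomentQ l₂ q := by
  induction l₁ with
  | nil => simp [xCellsMomentQ]
  | cons c cs ih => simp only [List.cons_append, xCellsMomentQ, ih, add_assoc]

/-- `xCellsAbsMomentQ` is additive over concatenation. [folklore] -/
theorem xCellsAbsMomentQ_append (l₁ l₂ : List XTCell) (q : ℕ) :
    xCellsAbsMomentQ (l₁ ++ l₂) q = xCellsAbsMomentQ l₁ q + xCellsAbsMomentQ l₂ q := by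
  induction l₁ with
  | nil => simp [xCellsAbsMomentQ]
  | cons c cs ih => simp only [List.cons_append, xCellsAbsMomentQ, ih, add_assoc]

end Summit.RiemannHypothesis.RiemannHypothesis.Theorems.EvenWinsBeyondArch

end
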